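import Summits.Langlands.Langlands.Theorems.RamifiedCoefficientSeedAdjointLiftingGL3BirthDefs4
import Summits.Langlands.Langlands.Theorems.RamifiedCoefficientSeedAdjointLiftingGL3StubResidualAdjointForm
import Summits.Langlands.Langlands.Theorems.RamifiedCoefficientSeedAdjointLiftingGL3StubAdjointResidualImage
import Summits.Langlands.Langlands.Theorems.TriangulineChamberLiftB2CrysSplitP
import Summits.Langlands.Langlands.Theorems.TriangulineChamberLiftB2CrysSplitPCompletion
import Literature.NumberTheory.PAdicHodge.FontaineDpst
import Literature.NumberTheory.GaloisRepresentations.ResidualRepRestrict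
import Literature.NumberTheory.GaloisRepresentations.ResidualRepUnique
import Literature.NumberTheory.GaloisRepresentations.ResidualGaloisRepOpenKernel
import Literature.NumberTheory.Automorphic.AdicCompletionResidueCard
import HarnessLib

/-!
# Crux `AdjointLiftingGL3` (stmt-Langlands-16779), line `birth`: stub S2a from its LOCAL core

Stub S2a of the skeleton (`stub_localShape : … → LocalShapeAt p ρ₀ η`, the Fontaine–Laffaille
analysis at the place above `p`) is reduced here to a purely LOCAL statement (the hypothesis
`hcore` of `stub_localShape_of_core`, proved in two registered halves `stub_localInertialType`,
`stub_localShapeWild` of skeleton v6): for a non-archimedean local field `K` with `#𝓀[K] = p`, a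
two-dimensional `V`, a character `χ` and `T = χ ⊗ ad⁰ V` (accepted `IsTwistedAdZero`) with open
kernels, the Fontaine–Laffaille data `FLDataAt K p T ι ϖ hϖ {0,1,2}` (conjuncts (i), (ii) of the
accepted clause (F13)) imply the local shape `LocalShapeOf K p V χ ι ϖ hϖ` (accepted, BirthDefs4).

The glue (this file, no `sorry`, no new definition, no named fact):
* `flDataAt_of_pinned` — clause (F13) of the pinned datum `fontainePstAdicCompletion v p hv` of
  `ℚ_v` (`FontaineDatumExists.pinnedFontaineLaffailleReductions`, p166439), applied to
  `ρ|_{Γ_{ℚ_v}}` (crystalline of labelled weights `{0,1,2}`: `CrysHT012`) and a reduction `T` of it,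
  IS `FLDataAt (ℚ_v) p T ι ϖ hϖ {0,1,2}`: `ℚ_p → ℚ_v` is onto (`rat_splitsCompletely`,
  `algebraMap_adicCompletion_surjective_of_split` of crux `LiftB2CrysSplitP`), a label exists, and the
  weights `{0,1,2}` lie in `[0, p-2]`.
* `localShapeOf_transfer` — `LocalShapeOf` is invariant under conjugating `V` and replacing `χ` by a
  character with the same values; `entry_eq_of_isReductionOf_one`, `exists_conj_of_isResidualRepOf_two`
  — any two reductions of the rank-one `η` agree, any two residual representations of `ρ₀` are
  conjugate (`IsResidualRepOf.nonempty_equiv`, `exists_conj_of_equiv`).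
* `stub_localShape_of_core` — S2a from the core: the absolutely irreducible reduction `τ` of `ρ`
  (`exists_isResidualRepOf_isAbsIrreducible`) has the adjoint form `τ = η̄ ⊗ ad⁰ τ₀`
  (`stub_residualAdjointForm`, S1); restrict to `Γ_{ℚ_v}` (`IsReductionOf.comp`), feed the core, and
  transfer to the given `(τ₀', η̄')`.
-/

set_option linter.dupNamespace false -- `Summit.Langlands.Langlands` is the mandated namespace

noncomputable section

namespace Summit.Langlands.Langlands.Cruxes.AdjointLiftingGL3.Birth

open scoped MatrixGroups NumberField Valued Polynomial
open NumberField IsDedekindDomain Field Filter ValuativeRel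
open Literature.NumberTheory.GaloisRepresentations Literature.NumberTheory.PAdicHodge
open Literature.NumberTheory.Automorphic
open Literature.NumberTheory.GaloisRepresentations.IsNonarchimedeanLocalField

section Transfer

variable {K : Type} [Field K] [ValuativeRel K] [TopologicalSpace K] [IsNonarchimedeanLocalField K]
  {p : ℕ} [Fact p.Prime]

/-- `LocalShapeOf` is invariant under conjugating `V` by a fixed `Q ∈ GL₂` and replacing `χ` by a
character with the same `(0,0)` entries. [folklore] -/
theorem localShapeOf_transfer
    {V V' : absoluteGaloisGroup K →* GL (Fin 2) (padicAlgClResidueField p)}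
    {χ χ' : absoluteGaloisGroup K →* GL (Fin 1) (padicAlgClResidueField p)}
    (Q : GL (Fin 2) (padicAlgClResidueField p)) (hV : ∀ g, V' g = Q * V g * Q⁻¹)
    (hχ : ∀ g, ((χ' g : GL (Fin 1) (padicAlgClResidueField p)) :
        Matrix (Fin 1) (Fin 1) (padicAlgClResidueField p)) 0 0 =
      ((χ g : GL (Fin 1) (padicAlgClResidueField p)) :
        Matrix (Fin 1) (Fin 1) (padicAlgClResidueField p)) 0 0)
    {ι : absIntegers 𝒪[K] K ⧸ absMaximalIdeal K →+* padicAlgClResidueField p} {ϖ : 𝒪[K]}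
    {hϖ : Irreducible ϖ} (h : LocalShapeOf K p V χ ι ϖ hϖ) : LocalShapeOf K p V' χ' ι ϖ hϖ := by
  obtain ⟨hE, s, hT⟩ := h
  refine ⟨fun σ => ?_, s, ?_⟩
  · rw [hχ]; exact hE σ
  have hconj : ∀ (P : GL (Fin 2) (padicAlgClResidueField p)) (g : absoluteGaloisGroup K),
      P * Q⁻¹ * V' g * (P * Q⁻¹)⁻¹ = P * V g * P⁻¹ := fun P g => by
    rw [hV g]; group
  rcases hT with ⟨P, hP, hwild⟩ | ⟨P, hP⟩
  · refine Or.inl ⟨P * Q⁻¹, fun σ => ?_, fun u hu σ hσ => ?_⟩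
    · obtain ⟨c, hc⟩ := hP σ
      exact ⟨c, by rw [hconj]; exact hc⟩
    · rw [hV, hwild u hu σ hσ, mul_one, mul_inv_cancel]
  · refine Or.inr ⟨P * Q⁻¹, fun σ => ?_⟩
    rw [hconj]; exact hP σ

end Transfer

section Rational

variable {p : ℕ} [Fact p.Prime]

/-- Any two reductions of a rank-one `η : Γ_ℚ → GL₁(ℚ̄_p)` have the same entries (their
characteristic polynomials `X - η̄(g)` agree, `HasResidualCharpolys.charpoly_eq`). [folklore] -/
theorem entry_eq_of_isReductionOf_one {η : FramedGaloisRep ℚ (PadicAlgCl p) 1}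
    {ηb ηb' : absoluteGaloisGroup ℚ →* GL (Fin 1) (padicAlgClResidueField p)}
    (h : η.IsReductionOf (RingHom.id _) ηb) (h' : η.IsReductionOf (RingHom.id _) ηb')
    (g : absoluteGaloisGroup ℚ) :
    ((ηb' g : GL (Fin 1) (padicAlgClResidueField p)) :
        Matrix (Fin 1) (Fin 1) (padicAlgClResidueField p)) 0 0 =
      ((ηb g : GL (Fin 1) (padicAlgClResidueField p)) :
        Matrix (Fin 1) (Fin 1) (padicAlgClResidueField p)) 0 0 := by
  have hc := HasResidualCharpolys.charpoly_eq h'.hasResidualCharpolys h.hasResidualCharpolys g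
  rw [Matrix.charpoly, Matrix.charpoly, Matrix.det_fin_one, Matrix.det_fin_one,
    Matrix.charmatrix_apply_eq, Matrix.charmatrix_apply_eq, sub_right_inj] at hc
  exact Polynomial.C_injective hc

/-- Any two residual representations of `ρ₀ : Γ_ℚ → GL₂(ℚ̄_p)` along `id` are conjugate
(Brauer–Nesbitt, `IsResidualRepOf.nonempty_equiv`, and `exists_conj_of_equiv`). [folklore] -/
theorem exists_conj_of_isResidualRepOf_two {ρ₀ : FramedGaloisRep ℚ (PadicAlgCl p) 2}
    {τ₀ τ₀' : absoluteGaloisGroup ℚ →* GL (Fin 2) (padicAlgClResidueField p)}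
    (h : ρ₀.IsResidualRepOf (RingHom.id _) τ₀) (h' : ρ₀.IsResidualRepOf (RingHom.id _) τ₀') :
    ∃ Q : GL (Fin 2) (padicAlgClResidueField p), ∀ g, τ₀' g = Q * τ₀ g * Q⁻¹ := by
  obtain ⟨e⟩ := IsResidualRepOf.nonempty_equiv h h'
  obtain ⟨Q, hQ⟩ := exists_conj_of_equiv e
  refine ⟨Q, fun g => Units.ext ?_⟩
  rw [hQ g, Units.val_mul, Units.val_mul]

/-- **Clause (F13) of the pinned datum of `ℚ_v` yields `FLDataAt`** for every reduction `T` of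
`ρ|_{Γ_{ℚ_v}}`, when `ρ|_{Γ_{ℚ_v}}` is crystalline with labelled Hodge–Tate weights `{0,1,2}`
(`CrysHT012`) and `p ≥ 4`: `ℚ_p → ℚ_v` is onto, a `ℚ_p`-label of `ℚ_v` exists, and `{0,1,2} ⊂ [0, p-2]`.
[cite: FontaineLaffaille1982, Prop. 4.4 and Thm. 5.3 (iii)] -/
theorem flDataAt_of_pinned (hFD : FontaineDatumExists) (hp : 4 ≤ p)
    (ρ : FramedGaloisRep ℚ (PadicAlgCl p) 3) (hcrys : CrysHT012 p ρ)
    (v : HeightOneSpectrum (𝓞 ℚ)) (hv : ((p : ℕ) : 𝓞 ℚ) ∈ v.asIdeal)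
    {T : absoluteGaloisGroup (v.adicCompletion ℚ) →* GL (Fin 3) (padicAlgClResidueField p)}
    (hred : (ρ.toLocal v).IsReductionOf (RingHom.id _) T)
    (ι : absIntegers (↥(ValuativeRel.valuation (v.adicCompletion ℚ)).integer) (v.adicCompletion ℚ) ⧸
        absMaximalIdeal (v.adicCompletion ℚ) →+* padicAlgClResidueField p)
    (ϖ : ↥(ValuativeRel.valuation (v.adicCompletion ℚ)).integer) (hϖ : Irreducible ϖ) :
    FLDataAt (v.adicCompletion ℚ) p T ι ϖ hϖ {0, 1, 2} := by
  set D := fontainePstAdicCompletion v p hv with hD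
  have hFL : D.FontaineLaffailleReductions :=
    fontaineLaffailleReductions_fontainePstAdicCompletion hFD v p hv
  obtain ⟨hcr, hw⟩ := hcrys v hv
  letI := D.algebra
  -- `ℚ_p → ℚ_v` is onto for the datum's (canonical) `ℚ_p`-structure
  have hsurj : Function.Surjective (algebraMap ℚ_[p] (v.adicCompletion ℚ)) := by
    have halg : D.algebra = LocalField.adicCompletionPadicAlgebra v p hv :=
      fontainePstAdicCompletion_algebra_eq_adicCompletionPadicAlgebra v p hv
    obtain ⟨hf, he⟩ := Theorems.LiftB2CrysSplitP.rat_splitsCompletely p v hv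
    have := Theorems.LiftB2CrysSplitP.algebraMap_adicCompletion_surjective_of_split v p hv hf he
    convert this
  -- a label `ℚ_v →ₐ[ℚ_p] ℚ̄_p`
  let e : ℚ_[p] ≃+* v.adicCompletion ℚ :=
    RingEquiv.ofBijective (algebraMap ℚ_[p] (v.adicCompletion ℚ))
      ⟨(algebraMap ℚ_[p] (v.adicCompletion ℚ)).injective, hsurj⟩
  let τL : v.adicCompletion ℚ →ₐ[ℚ_[p]] PadicAlgCl p :=
    { toRingHom := (algebraMap ℚ_[p] (PadicAlgCl p)).comp e.symm.toRingHom
      commutes' := fun x => by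
        change algebraMap ℚ_[p] (PadicAlgCl p) (e.symm (algebraMap ℚ_[p] (v.adicCompletion ℚ) x)) = _
        congr 1
        exact e.symm_apply_apply x }
  have hw' : D.𝔅.labelledHodgeTateWeights (ρ.toLocal v).toGaloisRep τL.toRingHom = {0, 1, 2} :=
    hw τL
  have hbd : ∀ x ∈ D.𝔅.labelledHodgeTateWeights (ρ.toLocal v).toGaloisRep τL.toRingHom,
      (0 : ℤ) ≤ x ∧ x ≤ 0 + (p - 2 : ℕ) := by
    intro x hx
    rw [hw'] at hx
    simp only [Multiset.insert_eq_cons, Multiset.mem_cons, Multiset.mem_singleton] at hx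
    have h2 : ((p - 2 : ℕ) : ℤ) = (p : ℤ) - 2 := by push_cast [Nat.cast_sub (by omega : 2 ≤ p)]; ring
    rcases hx with rfl | rfl | rfl <;> refine ⟨by norm_num, ?_⟩ <;> rw [h2] <;> omega
  have h := hFL hsurj (ρ.toLocal v) τL 0 hcr hbd T hred ι ϖ hϖ
  rw [hw'] at h
  exact h

/-- **Stub S2a from its local core.**  If the local core holds (hypothesis `hcore`: for every
non-archimedean local field `K` with `#𝓀[K] = p`, every `(V, χ, T = χ ⊗ ad⁰ V)` with open kernels and
Fontaine–Laffaille data of weights `{0,1,2}`, the local shape `LocalShapeOf K p V χ`), then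
`LocalShapeAt p ρ₀ η` follows from `CrysHT012 p ρ`, the residual absolute irreducibility of
`ρ|_{Γ_{ℚ(ζ_p)}}`, the adjoint seed and `FontaineDatumExists`: the absolutely irreducible reduction
`τ` of `ρ` is `η̄ ⊗ ad⁰ τ₀` (S1), its restriction to `Γ_{ℚ_v}` is a reduction of the crystalline
`ρ|_{Γ_{ℚ_v}}` to which (F13) applies, and the local shape of `(τ₀, η̄)` transfers to every residual
`τ₀'` of `ρ₀` (conjugate) and reduction `η̄'` of `η` (equal).
[cite: FontaineLaffaille1982, Thm. 5.3 (iii)] [cite: GeeHerzigLiuSavitt2017, Prop. 2.3.1]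
[cite: Serre1987, §2.2 and §2.4] -/
theorem stub_localShape_of_core :
    (∀ (p : ℕ) [Fact p.Prime], 11 ≤ p →
      ∀ (K : Type) [Field K] [ValuativeRel K] [TopologicalSpace K] [IsNonarchimedeanLocalField K],
        residueFieldCard K = p →
        ∀ (V : absoluteGaloisGroup K →* GL (Fin 2) (padicAlgClResidueField p))
          (χ : absoluteGaloisGroup K →* GL (Fin 1) (padicAlgClResidueField p))
          (T : absoluteGaloisGroup K →* GL (Fin 3) (padicAlgClResidueField p)),
          IsOpen (V.ker : Set (absoluteGaloisGroup K)) → IsOpen (χ.ker : Set (absoluteGaloisGroup K)) →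
          IsTwistedAdZero T V χ →
          ∀ (ι : absIntegers (↥(ValuativeRel.valuation K).integer) K ⧸ absMaximalIdeal K →+*
                padicAlgClResidueField p)
            (ϖ : ↥(ValuativeRel.valuation K).integer) (hϖ : Irreducible ϖ),
            FLDataAt K p T ι ϖ hϖ {0, 1, 2} → LocalShapeOf K p V χ ι ϖ hϖ) →
    ∀ (p : ℕ) [Fact p.Prime], 11 ≤ p →
      ∀ (ρ : FramedGaloisRep ℚ (PadicAlgCl p) 3) (ρ₀ : FramedGaloisRep ℚ (PadicAlgCl p) 2)
        (η : FramedGaloisRep ℚ (PadicAlgCl p) 1),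
        CrysHT012 p ρ → (ρ.restrictField (CyclotomicField p ℚ)).IsResiduallyAbsIrreducible →
        AdjointSeed p ρ ρ₀ η → FontaineDatumExists → LocalShapeAt p ρ₀ η := by
  intro hcore p _ hp ρ ρ₀ η hcrys hirr hseed hFD
  -- the absolutely irreducible reduction `τ` of `ρ` and its adjoint form (S1)
  obtain ⟨τ, hτres, hτred, -, hτirr⟩ := exists_isResidualRepOf_isAbsIrreducible ρ hirr
  obtain ⟨τ₀, ηb, hτ₀, hηb, -, htw, -, -⟩ :=
    stub_residualAdjointForm p (by omega) ρ ρ₀ η hseed τ hτres hτirr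
  rw [localShapeAt_iff]
  intro v hv τ₀' ηb' hτ₀' hηb' ιr ϖ hϖ
  -- the local objects at `K = ℚ_v`
  have hq : residueFieldCard (v.adicCompletion ℚ) = p := by
    rw [residueFieldCard_adicCompletion_eq]
    exact (Theorems.LiftB2CrysSplitP.rat_splitsCompletely p v hv).1
  set K := v.adicCompletion ℚ with hK
  set jm : absoluteGaloisGroup K →* absoluteGaloisGroup ℚ := (absGaloisRestrict ℚ K).toMonoidHom
    with hjm
  have hjc : Continuous jm := (absGaloisRestrict ℚ K).continuous_toFun
  have hopen : ∀ {m : ℕ} (f : absoluteGaloisGroup ℚ →* GL (Fin m) (padicAlgClResidueField p)),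
      IsOpen (f.ker : Set (absoluteGaloisGroup ℚ)) →
        IsOpen ((f.comp jm).ker : Set (absoluteGaloisGroup K)) := by
    intro m f hf
    have hset : ((f.comp jm).ker : Set (absoluteGaloisGroup K)) = jm ⁻¹' (f.ker : Set _) := by
      ext x; simp [MonoidHom.mem_ker]
    rw [hset]
    exact hf.preimage hjc
  have hV : IsOpen ((τ₀.comp jm).ker : Set (absoluteGaloisGroup K)) :=
    hopen τ₀ (FramedGaloisRep.isOpen_ker_of_isResidualRepOf hτ₀)
  have hχ : IsOpen ((ηb.comp jm).ker : Set (absoluteGaloisGroup K)) :=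
    hopen ηb (FramedGaloisRep.isOpen_ker_of_isReductionOf hηb)
  have hT : IsTwistedAdZero (τ.comp jm) (τ₀.comp jm) (ηb.comp jm) := by
    obtain ⟨P, hP⟩ := htw
    exact ⟨P, fun g => hP (jm g)⟩
  have hredL : (ρ.toLocal v).IsReductionOf (RingHom.id _) (τ.comp jm) := hτred.comp jm
  have hFL : FLDataAt K p (τ.comp jm) ιr ϖ hϖ {0, 1, 2} :=
    flDataAt_of_pinned hFD (by omega) ρ hcrys v hv hredL ιr ϖ hϖ
  have hloc : LocalShapeOf K p (τ₀.comp jm) (ηb.comp jm) ιr ϖ hϖ :=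
    hcore p hp K hq _ _ _ hV hχ hT ιr ϖ hϖ hFL
  -- transfer to the given residual `τ₀'` of `ρ₀` and reduction `ηb'` of `η`
  obtain ⟨Q, hQ⟩ := exists_conj_of_isResidualRepOf_two hτ₀ hτ₀'
  exact localShapeOf_transfer Q (fun g => hQ (jm g))
    (fun g => entry_eq_of_isReductionOf_one hηb hηb' (jm g)) hloc

end Rational

end Summit.Langlands.Langlands.Cruxes.AdjointLiftingGL3.Birth

end
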